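import Literature.Probability.RandomPlanarGeometry.CritPercSLESelfTouching
import Literature.Probability.RandomPlanarGeometry.SLESwallowAtOnce
import HarnessLib

/-!
# Real points are a.s. not visited by the SLE_κ trace, `4 < κ < 8` (Rohde–Schramm, Thm 6.4 / Lemma 6.6)

Topic `Probability/RandomPlanarGeometry`; theorems only (plus one measurable path-space event).
S. Rohde, O. Schramm, *Basic properties of SLE*, Ann. of Math. 161 (2005), proof of Thm 6.4
(p. 908): "Lemma 6.6 shows that `1 ∉ γ[0, ∞)` a.s., and the same follows for every
`z ∈ ℝ ∖ {0}` by scale and reflection invariance." We **discharge the named fact**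
`Literature.Probability.RandomPlanarGeometry.ae_sleTrace_firstHit_realRay_ne` of
`CritPercSLESwallowing.lean` (for `4 < κ < 8` and real `x ≠ 0`, a.s. the first point of the ray
`realRay x` on the trace is not `x`), `ae_sleTrace_firstHit_realRay_ne_holds`, and derive
`ae_ofReal_notMem_range_sleTrace`: **a fixed real `x ≠ 0` is a.s. not on the SLE_κ trace**.

The probabilistic input is the sharp form of the same-side swallowing estimate behind Lemma 6.6:

* `measureReal_swallowingTime_eq_ge` — for `4 < κ < 8`, `0 < y < x`, `z₀ = x/(x-y)`, every level
  `1 < 1 + δ₀ < z₀` and every upper bound `M` of `h = sameSideH (2/κ)` on `(1, ∞)`: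
  `h(z₀) - h(1+δ₀) ≤ (M - h(1+δ₀)) · P[T_y = T_x]`. This is the limiting argument of
  `measure_swallowingTime_eq_pos` (`SLESameSideSwallowing.lean`, which only recorded
  `P[T_y = T_x] ≥ c₁/2`), run without double counting: on the event `{h(Z_{t∧ρ}) > h(1+δ₀)}` of
  probability `≥ c₁`, either `T_y > t`, or `Y` has exceeded `R₁ - 1`, or *one of* "the ratio has
  exceeded `R`" / "both flows have been small together" has happened; along a diagonal
  `(R, δ₁) = (z₀ + k, y/(k+2))` the `limsup` of the last events lies in `{T_y = T_x} ∪ {T_y = ∞}`.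
* Since `h` is increasing and bounded above on `(1, ∞)` (`κ < 8`), `h(z₀) → sup h` as `y ↑ x`,
  and with `1 + δ₀ = 2` (`h(2) = 0`): `P[T_y = T_x] ≥ h(z₀)/sup h → 1`. Hence for `y > 0`, **almost
  surely some `x > y` is swallowed at the same time as `y`** (`ae_exists_swallowingTime_eq_of_pos`);
  by the reflection `W ↦ -W` (`identDistrib_sleDriving_neg`, `swallowingTime_neg_ofReal`) the same
  holds for `y < 0` with some `x < y` (`ae_exists_swallowingTime_eq_of_neg`).
* Deterministic link (`Loewner.IsGeneratedByCurve.apply_ne_of_firstHit_eq_of_swallowingTime_eq`):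
  for a chain generated by `γ` from `W 0 = 0`, if `T_y = T_x` for some `x` beyond `y` on the same
  side, then the first hit of `realRay y` is not at `y` — otherwise `T_y = t₀` (swallowing of real
  points is hitting of real rays, `swallowingTime_ofReal_eq_firstHit_of_ne`) while `γ[0, t₀]`
  misses the strictly smaller ray `realRay x`, forcing `T_x > t₀`.

On sample paths whose chain is not generated by a curve the trace is the junk constant `0`, which
never meets `realRay x`; so no trace-existence hypothesis is needed.

## References

* S. Rohde, O. Schramm, *Basic properties of SLE*, Ann. of Math. 161 (2005), Lemma 6.6 and its
  proof, proof of Thm 6.4 (p. 908).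
* G. F. Lawler, *Conformally Invariant Processes in the Plane*, AMS (2005), Prop. 6.33, Rem. 6.6.
-/

noncomputable section

open MeasureTheory ProbabilityTheory Filter Set Topology
open scoped NNReal ENNReal

namespace Literature.Probability.RandomPlanarGeometry

open Loewner Literature.Probability.Process Literature.Analysis.FunctionSpaces
  Literature.Analysis.Calculus

variable {κ : ℝ≥0} {x y : ℝ}

/-! ### The levels bound without double counting -/

section Levels

variable (hy : 0 < y) (hyx : y < x) {δ₀ R δ₁ R₁ : ℝ} (hδ₀ : 0 < δ₀) (hz₀ : 1 + δ₀ < x / (x - y))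
  (hz₀' : x / (x - y) < 1 + R) (hδ₁ : 0 < δ₁) (hδ₁y : δ₁ < y) (hyR₁ : y < R₁)
include hy hyx hδ₀ hz₀ hz₀' hδ₁ hδ₁y hyR₁

/-- **The stopped-martingale bound, union form**: for `4 < κ < 8`, `h = sameSideH (2/κ)`, any
bound `M` of `h` on `(1, ∞)` and the levels of `SLESameSideSwallowing`, for every `t`,
`h(z₀) - h(1+δ₀) ≤ (M - h(1+δ₀)) · (P[T_y > t] + P[Y exceeds R₁ - 1] +
P[ratio exceeds R or flows small])` (`sameSide_levels_bound` with the last two alternatives of the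
case analysis `sameSide_ratio_gt_subset` kept as one event). [cite: RohdeSchramm2005, proof of Lemma 6.6] -/
theorem sameSide_levels_bound_union (hκ4 : 4 < κ) {M : ℝ}
    (hM : ∀ z : ℝ, 1 < z → sameSideH (2 / (κ : ℝ)) z ≤ M) (t : ℝ≥0) :
    sameSideH (2 / (κ : ℝ)) (x / (x - y)) - sameSideH (2 / (κ : ℝ)) (1 + δ₀) ≤
      (M - sameSideH (2 / (κ : ℝ)) (1 + δ₀)) *
        (preWienerMeasure.real {ω | (t : WithTop ℝ≥0) < swallowingTime (sleDriving κ ω) y} +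
          preWienerMeasure.real (sleFlowExceeds κ y R₁) +
          preWienerMeasure.real (sleRatioExceeds κ x y R ∪ sleFlowsSmall κ x y ((1 + δ₀) / δ₀) δ₁)) := by
  haveI := isProbabilityMeasure_preWienerMeasure'
  have hx : 0 < x := hy.trans hyx
  have hκ0 : 0 < κ := lt_trans (by norm_num) hκ4
  set a : ℝ := 2 / (κ : ℝ) with ha
  set h := sameSideH a with hh
  have hz1 : 1 < 1 + δ₀ := by linarith
  -- a `C²` function equal to `h` near `[1+δ₀, 1+R]`
  obtain ⟨f, hf, hfeq, -⟩ := exists_contDiff_eqOn_Icc (n := 2) (a := 1) (b := R + 3) (lo := 1 + δ₀ / 2)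
    (hi := R + 2) (by linarith) (by linarith [hz₀.trans hz₀']) (by linarith)
    ((contDiffOn_two_sameSideH a).mono fun z hz ↦ (show (1 : ℝ) < z from hz.1))
  have hfnhds : ∀ z ∈ Icc (1 + δ₀) (1 + R), f =ᶠ[𝓝 z] h := by
    intro z hz
    have hmem : Ioo (1 + δ₀ / 2) (R + 2) ∈ 𝓝 z := Ioo_mem_nhds (by linarith [hz.1]) (by linarith [hz.2])
    filter_upwards [hmem] with u hu
    exact hfeq (Ioo_subset_Icc_self hu)
  have hzgt : ∀ z ∈ Icc (1 + δ₀) (1 + R), 1 < z := fun z hz ↦ lt_of_lt_of_le hz1 hz.1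
  have hf1 : ∀ z ∈ Icc (1 + δ₀) (1 + R), deriv f z = sameSideKernel a z := by
    intro z hz
    rw [(hfnhds z hz).deriv_eq]
    exact deriv_sameSideH a (hzgt z hz)
  have hf2 : ∀ z ∈ Icc (1 + δ₀) (1 + R),
      iteratedDeriv 2 f z = sameSideKernel a z * (-(2 * a) / z + 2 * a / (1 - z)) := by
    intro z hz
    rw [iteratedDeriv_succ, iteratedDeriv_one]
    have h1 : deriv f =ᶠ[𝓝 z] sameSideKernel a := by
      have hmem : Ioi (1 : ℝ) ∈ 𝓝 z := Ioi_mem_nhds (hzgt z hz)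
      filter_upwards [(hfnhds z hz).deriv, hmem] with u hu hu'
      rw [hu]
      exact deriv_sameSideH a hu'
    rw [h1.deriv_eq]
    exact (hasDerivAt_sameSideKernel a (hzgt z hz)).deriv
  have hmart := martingale_apply_sameSideRatio_stopped hκ0 hy hyx hδ₀ hz₀ hz₀' hδ₁ hδ₁y hyR₁ hf
    (K := sameSideKernel a) hf1 hf2
  set ρ := sleSameSideTime κ x y δ₀ R δ₁ R₁ with hρ
  set Zρ : ℝ≥0 → (ℝ≥0 → ℝ) → ℝ := fun t ω ↦ stoppedProcess (sleRealFlowStop κ x) ρ t ω /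
    (stoppedProcess (sleRealFlowStop κ x) ρ t ω - stoppedProcess (sleRealFlowStop κ y) ρ t ω) with hZρ
  -- the stopped ratio stays in `[1+δ₀, 1+R]`
  have hZmem : ∀ t ω, Zρ t ω ∈ Icc (1 + δ₀) (1 + R) := by
    intro t ω
    have h := (sleSameSide_bounds_of_le hy hyx hδ₀ hz₀ hz₀' hδ₁ hδ₁y hyR₁
      (coe_untopA_min_le t (ρ ω))).2.2.2.1
    simpa only [hZρ, stoppedProcess] using h
  have hO : ∀ t ω, f (Zρ t ω) = h (Zρ t ω) := fun t ω ↦ hfeq ⟨by linarith [(hZmem t ω).1], by linarith [(hZmem t ω).2]⟩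
  -- expectation of the martingale
  have hE : ∫ ω, f (Zρ t ω) ∂preWienerMeasure = h (x / (x - y)) := by
    have h1 := integral_eq_of_martingale hmart t
    rw [show (fun ω ↦ f (Zρ t ω)) = fun ω ↦ f (stoppedProcess (sleRealFlowStop κ x) ρ t ω /
      (stoppedProcess (sleRealFlowStop κ x) ρ t ω - stoppedProcess (sleRealFlowStop κ y) ρ t ω)) from rfl, h1]
    have h0 : ∀ ω, f (stoppedProcess (sleRealFlowStop κ x) ρ 0 ω /
        (stoppedProcess (sleRealFlowStop κ x) ρ 0 ω - stoppedProcess (sleRealFlowStop κ y) ρ 0 ω)) =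
        h (x / (x - y)) := by
      intro ω
      have := hO 0 ω
      simp only [hZρ, stoppedProcess, untopA_min_zero, sleRealFlowStop_zero_apply hx.ne',
        sleRealFlowStop_zero_apply hy.ne'] at this ⊢
      exact this
    simp only [h0, integral_const, smul_eq_mul, probReal_univ, one_mul]
  -- the event and the integral inequality
  set B : Set (ℝ≥0 → ℝ) := {ω | 1 + δ₀ < Zρ t ω} with hB
  have hBm : MeasurableSet B := by
    have hρst : IsStoppingTime brownianFiltration ρ :=
      isStoppingTime_sleSameSideTime (κ := κ) hy hyx hδ₁ hδ₁y hyR₁ δ₀ R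
    have hmx : Measurable (stoppedProcess (sleRealFlowStop κ x) ρ t) :=
      (((isStronglyProgressive_sleRealFlowStop κ hx.ne').stronglyAdapted_stoppedProcess hρst) t).measurable.mono
        (brownianFiltration.le t) le_rfl
    have hmy : Measurable (stoppedProcess (sleRealFlowStop κ y) ρ t) :=
      (((isStronglyProgressive_sleRealFlowStop κ hy.ne').stronglyAdapted_stoppedProcess hρst) t).measurable.mono
        (brownianFiltration.le t) le_rfl
    exact measurableSet_lt measurable_const (hmx.div (hmx.sub hmy))
  set Dn : ℝ := M - h (1 + δ₀) with hDn
  have hmono : StrictMonoOn h (Ioi 1) := strictMonoOn_sameSideH a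
  have hpt : ∀ ω, f (Zρ t ω) - h (1 + δ₀) ≤ Dn * B.indicator (fun _ ↦ (1 : ℝ)) ω := by
    intro ω
    rw [hO t ω]
    by_cases hω : ω ∈ B
    · rw [indicator_of_mem hω, mul_one]
      linarith [hM (Zρ t ω) (hzgt _ (hZmem t ω))]
    · rw [indicator_of_notMem hω, mul_zero, sub_nonpos]
      have hle : Zρ t ω ≤ 1 + δ₀ := not_lt.1 hω
      have heq : Zρ t ω = 1 + δ₀ := le_antisymm hle (hZmem t ω).1
      rw [heq]
  have hint : Integrable (fun ω ↦ f (Zρ t ω)) preWienerMeasure := hmart.integrable t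
  have hI : h (x / (x - y)) - h (1 + δ₀) ≤ Dn * preWienerMeasure.real B := by
    have h1 : ∫ ω, (f (Zρ t ω) - h (1 + δ₀)) ∂preWienerMeasure = h (x / (x - y)) - h (1 + δ₀) := by
      rw [integral_sub hint (integrable_const _), hE, integral_const, smul_eq_mul, probReal_univ, one_mul]
    have h2 : ∫ ω, Dn * B.indicator (fun _ ↦ (1 : ℝ)) ω ∂preWienerMeasure = Dn * preWienerMeasure.real B := by
      rw [integral_const_mul, integral_indicator_const _ hBm, smul_eq_mul, mul_one]
    rw [← h1, ← h2]
    exact integral_mono (hint.sub (integrable_const _))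
      ((integrable_const (1 : ℝ)).indicator hBm |>.const_mul Dn) hpt
  -- the case analysis bounds `P(B)`, keeping the last two alternatives together
  have hsub := sameSide_ratio_gt_subset (κ := κ) hy hyx hδ₀ hz₀ hz₀' hδ₁ hδ₁y hyR₁ t
  have hsub' : B ⊆ ({ω | (t : WithTop ℝ≥0) < swallowingTime (sleDriving κ ω) y} ∪ sleFlowExceeds κ y R₁) ∪
      (sleRatioExceeds κ x y R ∪ sleFlowsSmall κ x y ((1 + δ₀) / δ₀) δ₁) := by
    intro ω hω
    rcases hsub hω with ((h1 | h1) | h1) | h1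
    · exact Or.inl (Or.inl h1)
    · exact Or.inr (Or.inl h1)
    · exact Or.inl (Or.inr h1)
    · exact Or.inr (Or.inr h1)
  have hPB : preWienerMeasure.real B ≤
      preWienerMeasure.real {ω | (t : WithTop ℝ≥0) < swallowingTime (sleDriving κ ω) y} +
        preWienerMeasure.real (sleFlowExceeds κ y R₁) +
        preWienerMeasure.real (sleRatioExceeds κ x y R ∪ sleFlowsSmall κ x y ((1 + δ₀) / δ₀) δ₁) := by
    refine (measureReal_mono hsub').trans ?_
    refine (measureReal_union_le _ _).trans ?_
    gcongr
    exact measureReal_union_le _ _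
  have hDn0 : 0 ≤ Dn := by
    have h1 := hM (x / (x - y)) (hz1.trans hz₀)
    have h2 := hmono hz1 (hz1.trans hz₀) hz₀
    simp only [hDn]; linarith
  exact hI.trans (mul_le_mul_of_nonneg_left hPB hDn0)

end Levels

/-! ### The sharp same-side swallowing estimate -/

/-- **Sharp same-side swallowing estimate, `4 < κ < 8`.** For `0 < y < x`, `z₀ = x/(x-y)`, a level
`0 < δ₀` with `1 + δ₀ < z₀` and an upper bound `M` of `h = sameSideH (2/κ)` on `(1, ∞)`:
`h(z₀) - h(1+δ₀) ≤ (M - h(1+δ₀)) · P[T_y = T_x]`. (Optional stopping of `h(Z_{t∧ρ})`,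
`sameSide_levels_bound_union`, then `t → ∞` and `R₁ → ∞` using `T_y < ∞` a.s. for `κ > 4`, and the
diagonal `(R, δ₁) = (z₀ + k, y/(k+2))`: a path in infinitely many of the events "ratio exceeded
`z₀ + k`" or "flows small at scale `y/(k+2)`" has `T_y = T_x` or `T_y = ∞`,
`swallowingTime_eq_of_forall_sleRatioExceeds`, `swallowingTime_eq_of_frequently_sleFlowsSmall`.)
This is the hitting-probability content of Rohde–Schramm's (6.13) in inequality form.
[cite: RohdeSchramm2005, Lemma 6.6] -/
theorem measureReal_swallowingTime_eq_ge (hκ4 : 4 < κ) (hy : 0 < y) (hyx : y < x)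
    {δ₀ : ℝ} (hδ₀ : 0 < δ₀) (hz₀ : 1 + δ₀ < x / (x - y)) {M : ℝ}
    (hM : ∀ z : ℝ, 1 < z → sameSideH (2 / (κ : ℝ)) z ≤ M) :
    sameSideH (2 / (κ : ℝ)) (x / (x - y)) - sameSideH (2 / (κ : ℝ)) (1 + δ₀) ≤
      (M - sameSideH (2 / (κ : ℝ)) (1 + δ₀)) *
        preWienerMeasure.real {ω | swallowingTime (sleDriving κ ω) y = swallowingTime (sleDriving κ ω) x} := by
  haveI := isProbabilityMeasure_preWienerMeasure'
  set μ : Measure (ℝ≥0 → ℝ) := preWienerMeasure with hμ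
  have hx : 0 < x := hy.trans hyx
  have hxy : 0 < x - y := by linarith
  set a : ℝ := 2 / (κ : ℝ) with ha
  set h := sameSideH a with hh
  set z₀ : ℝ := x / (x - y) with hz₀def
  have hz1 : (1 : ℝ) < 1 + δ₀ := by linarith
  have hmono : StrictMonoOn h (Ioi 1) := strictMonoOn_sameSideH a
  set c₀ : ℝ := h z₀ - h (1 + δ₀) with hc₀
  set Dn : ℝ := M - h (1 + δ₀) with hDn
  have hDn0 : 0 ≤ Dn := by
    have h1 := hM z₀ (hz1.trans hz₀)
    have h2 := hmono hz1 (hz1.trans hz₀) hz₀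
    simp only [hDn]; linarith
  set C : ℝ := (1 + δ₀) / δ₀ with hC
  -- the good event and the null event
  set E : Set (ℝ≥0 → ℝ) := {ω | swallowingTime (sleDriving κ ω) y = swallowingTime (sleDriving κ ω) x} with hE
  set N : Set (ℝ≥0 → ℝ) := {ω | swallowingTime (sleDriving κ ω) y = ⊤} with hN
  have hN0 : μ N = 0 := by
    have hae := sle_swallowingTime_lt_top_of_onePointMartingales sle_martingale_onePointPow_holds
      sle_martingale_onePointSq_holds hκ4 hy
    rw [ae_iff] at hae
    refine measure_mono_null (fun ω hω ↦ ?_) hae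
    simp only [mem_setOf_eq] at hω ⊢
    rw [hω]; exact lt_irrefl _
  set p : ℝ := μ.real (E ∪ N) with hp
  have hpE : p ≤ μ.real E := by
    calc p ≤ μ.real E + μ.real N := measureReal_union_le _ _
      _ = μ.real E := by rw [show μ.real N = 0 by simp [measureReal_def, hN0], add_zero]
  -- the diagonal events `S k = {ratio exceeds z₀ + k + 1} ∪ {flows small at scale y/(k+2)}`
  set S : ℕ → Set (ℝ≥0 → ℝ) := fun k ↦
    sleRatioExceeds κ x y (z₀ + k) ∪ sleFlowsSmall κ x y C (y / (k + 2)) with hSdef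
  have hSm : ∀ k, MeasurableSet (S k) := fun k ↦
    (measurableSet_sleRatioExceeds hy hyx _).union (measurableSet_sleFlowsSmall hy hyx _ _)
  -- STEP A: the levels bound along the diagonal
  have hA : ∀ (k m : ℕ) (t : ℝ≥0),
      c₀ ≤ Dn * (μ.real {ω | (t : WithTop ℝ≥0) < swallowingTime (sleDriving κ ω) y} +
        μ.real (sleFlowExceeds κ y (y + m + 1)) + μ.real (S k)) := by
    intro k m t
    have hδ₁ : 0 < y / (k + 2) := by positivity
    have hδ₁y : y / (k + 2) < y := by rw [div_lt_iff₀ (by positivity)]; nlinarith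
    have hyR₁ : y < y + m + 1 := by linarith [m.cast_nonneg (α := ℝ)]
    have hR : z₀ < 1 + (z₀ + k) := by linarith [k.cast_nonneg (α := ℝ)]
    exact sameSide_levels_bound_union (κ := κ) hy hyx hδ₀ hz₀ hR hδ₁ hδ₁y hyR₁ hκ4 hM t
  -- STEP B1: `P[T_y > t] → 0`
  have hB1 : Tendsto (fun k : ℕ ↦ μ.real {ω | ((k : ℝ≥0) : WithTop ℝ≥0) < swallowingTime (sleDriving κ ω) y})
      atTop (𝓝 0) := by
    set S' : ℕ → Set (ℝ≥0 → ℝ) := fun k ↦ {ω | ((k : ℝ≥0) : WithTop ℝ≥0) < swallowingTime (sleDriving κ ω) y}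
      with hS'def
    have hS'm : ∀ k, MeasurableSet (S' k) := fun k ↦ by
      have : S' k = {ω | 0 < sleRealFlowStop κ y k ω} := by
        ext ω
        simp only [hS'def, mem_setOf_eq, sleRealFlowStop_apply]
        rw [realFlowStop_pos_iff (continuous_sleDriving κ ω) (by rw [sleDriving_zero]; exact hy)]
      rw [this]
      exact measurableSet_lt measurable_const ((adapted_sleRealFlowStop κ hy.ne' _).mono (brownianFiltration.le _) le_rfl)
    have hS'anti : Antitone S' := by
      intro k l hkl ω hω
      simp only [hS'def, mem_setOf_eq] at hω ⊢
      exact lt_of_le_of_lt (by exact_mod_cast hkl) hω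
    have hinter : μ (⋂ k, S' k) = 0 := by
      refine measure_mono_null (fun ω hω ↦ ?_) hN0
      simp only [hS'def, mem_iInter, mem_setOf_eq] at hω ⊢
      by_contra hT
      obtain ⟨T, hT'⟩ := WithTop.ne_top_iff_exists.1 hT
      obtain ⟨k, hk⟩ := exists_nat_gt (T : ℝ)
      have := hω k
      rw [← hT', WithTop.coe_lt_coe] at this
      have : (k : ℝ) < T := by exact_mod_cast this
      linarith
    have ht := tendsto_measure_iInter_atTop (μ := μ) (fun k ↦ (hS'm k).nullMeasurableSet) hS'anti ⟨0, measure_ne_top _ _⟩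
    rw [hinter] at ht
    have := (ENNReal.tendsto_toReal ENNReal.zero_ne_top).comp ht
    rw [ENNReal.toReal_zero] at this
    refine this.congr fun k ↦ ?_
    simp only [Function.comp_apply, hS'def, measureReal_def]
  -- STEP B2: `P[Y exceeds R₁ - 1] → 0`
  have hB2 : Tendsto (fun m : ℕ ↦ μ.real (sleFlowExceeds κ y (y + m + 1))) atTop (𝓝 0) := by
    set S' : ℕ → Set (ℝ≥0 → ℝ) := fun m ↦ sleFlowExceeds κ y (y + m + 1) with hS'def
    have hS'm : ∀ m, MeasurableSet (S' m) := fun m ↦ measurableSet_sleFlowExceeds hy _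
    have hS'anti : Antitone S' := by
      refine antitone_nat_of_succ_le fun m ω hω ↦ ?_
      simp only [hS'def] at hω ⊢
      obtain ⟨q, hq0, hq⟩ := hω
      refine ⟨q, hq0, ?_⟩
      push_cast at hq ⊢
      linarith
    have hinter : μ (⋂ m, S' m) = 0 := by
      refine measure_mono_null (fun ω hω ↦ ?_) hN0
      simp only [hS'def, mem_iInter] at hω
      exact swallowingTime_eq_top_of_forall_sleFlowExceeds hy fun n ↦ by
        obtain ⟨m, hm⟩ := exists_nat_ge ((n : ℝ) - y)
        obtain ⟨q, hq0, hq⟩ := hω m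
        exact ⟨q, hq0, by linarith⟩
    have ht := tendsto_measure_iInter_atTop (μ := μ) (fun m ↦ (hS'm m).nullMeasurableSet) hS'anti ⟨0, measure_ne_top _ _⟩
    rw [hinter] at ht
    have := (ENNReal.tendsto_toReal ENNReal.zero_ne_top).comp ht
    rw [ENNReal.toReal_zero] at this
    refine this.congr fun m ↦ ?_
    simp only [Function.comp_apply, hS'def, measureReal_def]
  -- STEP C: `c₀ ≤ Dn · P(S k)` for every `k`
  have hC' : ∀ k : ℕ, c₀ ≤ Dn * μ.real (S k) := by
    intro k
    refine le_of_forall_pos_lt_add fun ε hε ↦ ?_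
    have hε2 : 0 < ε / 2 / (Dn + 1) := by positivity
    obtain ⟨t, ht⟩ := (hB1.eventually (gt_mem_nhds hε2)).exists
    obtain ⟨m, hm⟩ := (hB2.eventually (gt_mem_nhds hε2)).exists
    have h1 := hA k m t
    have h2 : Dn * (μ.real {ω | ((t : ℝ≥0) : WithTop ℝ≥0) < swallowingTime (sleDriving κ ω) y} +
        μ.real (sleFlowExceeds κ y (y + m + 1))) ≤ Dn * (ε / 2 / (Dn + 1) + ε / 2 / (Dn + 1)) :=
      mul_le_mul_of_nonneg_left (by linarith) hDn0
    have h3 : Dn * (ε / 2 / (Dn + 1) + ε / 2 / (Dn + 1)) < ε := by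
      have h4 : ε / 2 / (Dn + 1) + ε / 2 / (Dn + 1) = ε / (Dn + 1) := by ring
      rw [h4, ← mul_div_assoc, div_lt_iff₀ (by positivity)]
      nlinarith
    nlinarith [mul_add Dn (μ.real {ω | ((t : ℝ≥0) : WithTop ℝ≥0) < swallowingTime (sleDriving κ ω) y} +
        μ.real (sleFlowExceeds κ y (y + m + 1))) (μ.real (S k))]
  -- STEP D: the `limsup` of the diagonal events lies in `E ∪ N`
  set U : ℕ → Set (ℝ≥0 → ℝ) := fun K ↦ ⋃ k, ⋃ (_ : K ≤ k), S k with hUdef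
  have hUm : ∀ K, MeasurableSet (U K) := fun K ↦
    MeasurableSet.iUnion fun k ↦ MeasurableSet.iUnion fun _ ↦ hSm k
  have hUanti : Antitone U := fun K K' hKK' ω hω ↦ by
    simp only [hUdef, mem_iUnion] at hω ⊢
    obtain ⟨k, hk, hmem⟩ := hω
    exact ⟨k, hKK'.trans hk, hmem⟩
  have hinter : μ (⋂ K, U K) ≤ μ (E ∪ N) := by
    refine measure_mono fun ω hω ↦ ?_
    simp only [hUdef, mem_iInter, mem_iUnion] at hω
    by_cases hT : swallowingTime (sleDriving κ ω) y = ⊤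
    · exact Or.inr hT
    left
    -- either the ratio events happen for arbitrarily large `k`, or the small-flows events do
    by_cases hrat : ∀ K : ℕ, ∃ k, K ≤ k ∧ ω ∈ sleRatioExceeds κ x y (z₀ + k)
    · refine swallowingTime_eq_of_forall_sleRatioExceeds hy hyx (fun n ↦ ?_) hT
      obtain ⟨K, hK⟩ := exists_nat_ge ((n : ℝ) - z₀)
      obtain ⟨k, hKk, q, hq0, hq⟩ := hrat K
      refine ⟨q, hq0, lt_of_le_of_lt ?_ hq⟩
      have : (K : ℝ) ≤ k := by exact_mod_cast hKk
      linarith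
    · push Not at hrat
      obtain ⟨K₀, hK₀⟩ := hrat
      refine swallowingTime_eq_of_frequently_sleFlowsSmall hy hyx (C := C) (d := fun k : ℕ ↦ y / (k + 2))
        ?_ ?_ hT
      · have h1 : Tendsto (fun k : ℕ ↦ y * (1 / ((k : ℝ) + 2))) atTop (𝓝 (y * 0)) := by
          refine (tendsto_const_nhds.div_atTop ?_).const_mul y
          exact tendsto_atTop_add_const_right _ _ tendsto_natCast_atTop_atTop
        rw [mul_zero] at h1
        refine h1.congr fun k ↦ ?_
        ring
      · rw [frequently_atTop]
        intro n
        obtain ⟨k, hk, hmem⟩ := hω (max n K₀)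
        refine ⟨k, (le_max_left _ _).trans hk, ?_⟩
        rcases hmem with h1 | h1
        · exact absurd h1 (hK₀ k ((le_max_right _ _).trans hk))
        · exact h1
  have ht := tendsto_measure_iInter_atTop (μ := μ) (fun K ↦ (hUm K).nullMeasurableSet) hUanti ⟨0, measure_ne_top _ _⟩
  have htr := (ENNReal.tendsto_toReal (measure_ne_top _ _)).comp ht
  have hlim : (μ (⋂ K, U K)).toReal ≤ p := by
    rw [hp, measureReal_def]
    exact ENNReal.toReal_mono (measure_ne_top _ _) hinter
  have hge : ∀ K, c₀ ≤ Dn * (μ (U K)).toReal := fun K ↦ by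
    refine (hC' K).trans (mul_le_mul_of_nonneg_left ?_ hDn0)
    rw [← measureReal_def]
    exact measureReal_mono (fun ω hω ↦ by simp only [hUdef, mem_iUnion]; exact ⟨K, le_rfl, hω⟩)
      (measure_ne_top _ _)
  have hc₀le : c₀ ≤ Dn * (μ (⋂ K, U K)).toReal :=
    ge_of_tendsto' (htr.const_mul Dn) hge
  calc c₀ ≤ Dn * (μ (⋂ K, U K)).toReal := hc₀le
    _ ≤ Dn * p := mul_le_mul_of_nonneg_left hlim hDn0
    _ ≤ Dn * μ.real E := mul_le_mul_of_nonneg_left hpE hDn0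

/-! ### The event `{T_y = T_x}` on the path space -/

/-- The path-space event **`{T_y = T_x}`** for two positive points (read through the regularised
path, cf. `swallowAtOncePosEvent`): `T_x ≤ q ↔ T_y ≤ q` for every rational time `q`. [folklore] -/
def swallowTogetherEvent (x y : ℝ) : Set (ℝ≥0 → ℝ) :=
  ⋂ q : ℚ, {w | w ∈ swallowLeEvent x (ratTime q) ↔ w ∈ swallowLeEvent y (ratTime q)}

/-- `swallowTogetherEvent x y` is measurable (`x, y > 0`). [folklore] -/
theorem measurableSet_swallowTogetherEvent (hx : 0 < x) (hy : 0 < y) :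
    MeasurableSet (swallowTogetherEvent x y) :=
  MeasurableSet.iInter fun q ↦ measurableSet_setOf_iff (measurableSet_swallowLeEvent hx (ratTime q))
    (measurableSet_swallowLeEvent hy (ratTime q))

/-- For a continuous path from `0`: membership in `swallowTogetherEvent x y` is `T_y = T_x`.
[folklore] -/
theorem mem_swallowTogetherEvent_iff {w : ℝ≥0 → ℝ} (hw : Continuous w) (hw0 : w 0 = 0) (x y : ℝ) :
    w ∈ swallowTogetherEvent x y ↔ swallowingTime w y = swallowingTime w x := by
  simp only [swallowTogetherEvent, mem_iInter, mem_setOf_eq, mem_swallowLeEvent_iff hw hw0]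
  constructor
  · intro hiff
    by_contra hne
    rcases lt_or_gt_of_ne hne with hlt | hlt
    · obtain ⟨q, h1, h2⟩ := exists_ratTime_of_lt hlt
      exact h2 ((hiff q).2 h1)
    · obtain ⟨q, h1, h2⟩ := exists_ratTime_of_lt hlt
      exact h2 ((hiff q).1 h1)
  · intro heq q
    rw [heq]

/-- **`{T_y = T_x}` is measurable** for the SLE_κ driving function and `x, y > 0`. [folklore] -/
theorem measurableSet_sle_swallowingTime_eq (κ : ℝ≥0) (hx : 0 < x) (hy : 0 < y) :
    MeasurableSet {ω : ℝ≥0 → ℝ | swallowingTime (sleDriving κ ω) y = swallowingTime (sleDriving κ ω) x} := by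
  have hset : {ω : ℝ≥0 → ℝ | swallowingTime (sleDriving κ ω) y = swallowingTime (sleDriving κ ω) x} =
      (fun ω t ↦ sleDriving κ ω t) ⁻¹' swallowTogetherEvent x y := by
    ext ω
    exact (mem_swallowTogetherEvent_iff (continuous_sleDriving κ ω) (sleDriving_zero κ ω) x y).symm
  rw [hset]
  exact measurable_sleDriving_pi κ (measurableSet_swallowTogetherEvent hx hy)

/-- **`{T_y = T_x}` is measurable** for the SLE_κ driving function and `x, y < 0` (through the
reflected path, `swallowingTime_neg_ofReal`). [folklore] -/
theorem measurableSet_sle_swallowingTime_eq_of_neg (κ : ℝ≥0) (hx : x < 0) (hy : y < 0) :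
    MeasurableSet {ω : ℝ≥0 → ℝ | swallowingTime (sleDriving κ ω) y = swallowingTime (sleDriving κ ω) x} := by
  have hset : {ω : ℝ≥0 → ℝ | swallowingTime (sleDriving κ ω) y = swallowingTime (sleDriving κ ω) x} =
      (fun ω t ↦ -sleDriving κ ω t) ⁻¹' swallowTogetherEvent (-x) (-y) := by
    ext ω
    rw [mem_preimage, mem_swallowTogetherEvent_iff (w := fun t ↦ -sleDriving κ ω t)
      (continuous_sleDriving κ ω).neg (by simp [sleDriving_zero]) (-x) (-y),
      swallowingTime_neg_ofReal, swallowingTime_neg_ofReal]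
    rfl
  rw [hset]
  exact (measurable_pi_lambda _ fun t ↦ (measurable_sleDriving κ _).neg)
    (measurableSet_swallowTogetherEvent (neg_pos.2 hx) (neg_pos.2 hy))

/-! ### `P[T_y = T_x] → 1` as `x ↓ y` -/

/-- **`P[T_y = T_x] → 1` as `x ↓ y > 0`, `4 < κ < 8`**: for every `ε > 0` there is `η > 0` such that
`P[T_y = T_x] ≥ 1 - ε` for all `x ∈ (y, y + η]`. With `h = sameSideH (2/κ)` (increasing, bounded
above on `(1, ∞)` since `κ < 8`, `h(2) = 0`) and `L = sup h`: by `measureReal_swallowingTime_eq_ge`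
at the level `1 + δ₀ = 2`, `P[T_y = T_x] ≥ h(z₀)/L`, and `h(z₀) → L` as `z₀ = x/(x-y) → ∞`.
[cite: RohdeSchramm2005, Lemma 6.6] -/
theorem exists_measureReal_swallowingTime_eq_ge_of_pos (hκ4 : 4 < κ) (hκ8 : κ < 8) (hy : 0 < y)
    {ε : ℝ} (hε : 0 < ε) :
    ∃ η : ℝ, 0 < η ∧ ∀ x : ℝ, y < x → x ≤ y + η →
      1 - ε ≤ preWienerMeasure.real
        {ω | swallowingTime (sleDriving κ ω) y = swallowingTime (sleDriving κ ω) x} := by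
  haveI := isProbabilityMeasure_preWienerMeasure'
  set a : ℝ := 2 / (κ : ℝ) with ha
  have hκ4' : (4 : ℝ) < κ := by exact_mod_cast hκ4
  have hκ8' : (κ : ℝ) < 8 := by exact_mod_cast hκ8
  have ha4 : 1 / 4 < a := by rw [ha, div_lt_div_iff₀ (by norm_num) (by linarith)]; linarith
  set h := sameSideH a with hh
  have hmono : StrictMonoOn h (Ioi 1) := strictMonoOn_sameSideH a
  -- `L = sup h` over `(1, ∞)`
  have hbdd : BddAbove (h '' Ioi 1) := by
    refine ⟨(2 : ℝ) ^ (2 * a) * ((2 : ℝ) ^ (1 - 4 * a) / (4 * a - 1)), ?_⟩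
    rintro _ ⟨z, hz, rfl⟩
    exact sameSideH_le ha4 hz
  have hne : (h '' Ioi 1).Nonempty := ⟨h 2, 2, by norm_num, rfl⟩
  set L : ℝ := sSup (h '' Ioi 1) with hL
  have hleL : ∀ z : ℝ, 1 < z → h z ≤ L := fun z hz ↦ le_csSup hbdd ⟨z, hz, rfl⟩
  have h2 : h 2 = 0 := sameSideH_two a
  have hL0 : 0 < L := by
    have h3 : h 2 < h 3 := hmono (by norm_num) (by norm_num) (by norm_num)
    rw [h2] at h3
    exact h3.trans_le (hleL 3 (by norm_num))
  -- a level `z₁ > 2` with `h z₁ > L (1 - ε)`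
  obtain ⟨_, ⟨z₁', hz₁', rfl⟩, hz₁⟩ := exists_lt_of_lt_csSup hne (show L * (1 - ε) < L by nlinarith)
  set z₁ : ℝ := max z₁' 3 with hz₁def
  have hz₁2 : 2 < z₁ := lt_of_lt_of_le (by norm_num) (le_max_right _ _)
  have hhz₁ : L * (1 - ε) < h z₁ := by
    rcases le_total z₁' 3 with hle | hle
    · rw [hz₁def, max_eq_right hle]
      rcases hle.eq_or_lt with heq | hlt
      · rw [← heq]; exact hz₁
      · exact hz₁.trans (hmono hz₁' (by norm_num : (3 : ℝ) ∈ Ioi 1) hlt)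
    · rw [hz₁def, max_eq_left hle]; exact hz₁
  -- `η = y/(z₁ - 1)`: for `x ∈ (y, y + η]`, `z₀ = x/(x-y) ≥ z₁`
  refine ⟨y / (z₁ - 1), div_pos hy (by linarith), fun x hyx hxη ↦ ?_⟩
  have hxy : 0 < x - y := by linarith
  set z₀ : ℝ := x / (x - y) with hz₀def
  have hz₀ : z₁ ≤ z₀ := by
    rw [hz₀def, le_div_iff₀ hxy]
    have h1 : (x - y) * (z₁ - 1) ≤ y := by
      have := (le_div_iff₀ (show (0 : ℝ) < z₁ - 1 by linarith)).1 (show x - y ≤ y / (z₁ - 1) by linarith)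
      linarith
    nlinarith
  have hhz₀ : h z₁ ≤ h z₀ := hmono.monotoneOn (show (1 : ℝ) < z₁ by linarith)
    (show (1 : ℝ) < z₀ by linarith) hz₀
  have hbound := measureReal_swallowingTime_eq_ge hκ4 hy hyx (δ₀ := 1) one_pos
    (by rw [← hz₀def]; linarith) (M := L) hleL
  rw [show (1 : ℝ) + 1 = 2 by norm_num, ← hh, h2, sub_zero, sub_zero, ← hz₀def] at hbound
  -- `h z₀ ≤ L · P`, `L(1-ε) < h z₀`, `L > 0`
  have hP : L * (1 - ε) < L * preWienerMeasure.real
      {ω | swallowingTime (sleDriving κ ω) y = swallowingTime (sleDriving κ ω) x} :=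
    lt_of_lt_of_le (hhz₁.trans_le hhz₀) hbound
  exact (lt_of_mul_lt_mul_left hP hL0.le).le

/-- **`P[T_y = T_x] → 1` as `x ↑ y < 0`, `4 < κ < 8`** (reflection `W ↦ -W` of
`exists_measureReal_swallowingTime_eq_ge_of_pos`: `identDistrib_sleDriving_neg`,
`swallowingTime_neg_ofReal`). [cite: RohdeSchramm2005, Lemma 6.6] -/
theorem exists_measureReal_swallowingTime_eq_ge_of_neg (hκ4 : 4 < κ) (hκ8 : κ < 8) (hy : y < 0)
    {ε : ℝ} (hε : 0 < ε) :
    ∃ η : ℝ, 0 < η ∧ ∀ x : ℝ, x < y → y - η ≤ x →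
      1 - ε ≤ preWienerMeasure.real
        {ω | swallowingTime (sleDriving κ ω) y = swallowingTime (sleDriving κ ω) x} := by
  obtain ⟨η, hη, hbound⟩ := exists_measureReal_swallowingTime_eq_ge_of_pos hκ4 hκ8 (neg_pos.2 hy) hε
  refine ⟨η, hη, fun x hxy hxη ↦ ?_⟩
  have h1 := hbound (-x) (by linarith) (by linarith)
  have hmeas := measurableSet_swallowTogetherEvent (x := -x) (y := -y) (by linarith) (by linarith)
  have hlaw := (identDistrib_sleDriving_neg κ).measure_mem_eq hmeas
  have hpos : {ω : ℝ≥0 → ℝ | swallowingTime (sleDriving κ ω) ((-y : ℝ) : ℂ) =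
      swallowingTime (sleDriving κ ω) ((-x : ℝ) : ℂ)} = (fun ω t ↦ sleDriving κ ω t) ⁻¹' swallowTogetherEvent (-x) (-y) := by
    ext ω
    exact (mem_swallowTogetherEvent_iff (continuous_sleDriving κ ω) (sleDriving_zero κ ω) (-x) (-y)).symm
  have hneg : {ω : ℝ≥0 → ℝ | swallowingTime (sleDriving κ ω) y = swallowingTime (sleDriving κ ω) x} =
      (fun ω t ↦ -sleDriving κ ω t) ⁻¹' swallowTogetherEvent (-x) (-y) := by
    ext ω
    rw [mem_preimage, mem_swallowTogetherEvent_iff (w := fun t ↦ -sleDriving κ ω t)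
      (continuous_sleDriving κ ω).neg (by simp [sleDriving_zero]) (-x) (-y),
      swallowingTime_neg_ofReal, swallowingTime_neg_ofReal]
    rfl
  rw [measureReal_def, hneg, ← hlaw, ← hpos, ← measureReal_def]
  exact h1

/-! ### Almost surely a point beyond `y` is swallowed together with `y` -/

/-- **For `y > 0` and `4 < κ < 8`, a.s. some `x > y` has `T_y = T_x`.** The events
`{T_y = T_{y + η_n}}` have probability `→ 1` (`exists_measureReal_swallowingTime_eq_ge_of_pos`).
[cite: RohdeSchramm2005, Thm 6.4 (proof, p. 908)] -/
theorem ae_exists_swallowingTime_eq_of_pos (hκ4 : 4 < κ) (hκ8 : κ < 8) (hy : 0 < y) :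
    ∀ᵐ ω ∂preWienerMeasure, ∃ x : ℝ, y < x ∧
      swallowingTime (sleDriving κ ω) y = swallowingTime (sleDriving κ ω) x := by
  haveI := isProbabilityMeasure_preWienerMeasure'
  rw [ae_iff]
  refine (measureReal_eq_zero_iff (measure_ne_top _ _)).1 (le_antisymm ?_ measureReal_nonneg)
  refine le_of_forall_pos_le_add fun ε hε ↦ ?_
  rw [zero_add]
  obtain ⟨η, hη, hbound⟩ := exists_measureReal_swallowingTime_eq_ge_of_pos hκ4 hκ8 hy hε
  set E : Set (ℝ≥0 → ℝ) := {ω | swallowingTime (sleDriving κ ω) y = swallowingTime (sleDriving κ ω) ↑(y + η)}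
    with hE
  have hEm : MeasurableSet E := measurableSet_sle_swallowingTime_eq κ (by linarith) hy
  have hsub : {ω : ℝ≥0 → ℝ | ¬ ∃ x : ℝ, y < x ∧
      swallowingTime (sleDriving κ ω) y = swallowingTime (sleDriving κ ω) x} ⊆ Eᶜ :=
    fun ω hω hωE ↦ hω ⟨y + η, by linarith, hωE⟩
  calc preWienerMeasure.real {ω : ℝ≥0 → ℝ | ¬ ∃ x : ℝ, y < x ∧
        swallowingTime (sleDriving κ ω) y = swallowingTime (sleDriving κ ω) x}
      ≤ preWienerMeasure.real Eᶜ := measureReal_mono hsub (measure_ne_top _ _)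
    _ = 1 - preWienerMeasure.real E := by rw [measureReal_compl hEm, probReal_univ]
    _ ≤ ε := by linarith [hbound (y + η) (by linarith) le_rfl]

/-- **For `y < 0` and `4 < κ < 8`, a.s. some `x < y` has `T_y = T_x`** (reflection).
[cite: RohdeSchramm2005, Thm 6.4 (proof, p. 908)] -/
theorem ae_exists_swallowingTime_eq_of_neg (hκ4 : 4 < κ) (hκ8 : κ < 8) (hy : y < 0) :
    ∀ᵐ ω ∂preWienerMeasure, ∃ x : ℝ, x < y ∧
      swallowingTime (sleDriving κ ω) y = swallowingTime (sleDriving κ ω) x := by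
  haveI := isProbabilityMeasure_preWienerMeasure'
  rw [ae_iff]
  refine (measureReal_eq_zero_iff (measure_ne_top _ _)).1 (le_antisymm ?_ measureReal_nonneg)
  refine le_of_forall_pos_le_add fun ε hε ↦ ?_
  rw [zero_add]
  obtain ⟨η, hη, hbound⟩ := exists_measureReal_swallowingTime_eq_ge_of_neg hκ4 hκ8 hy hε
  set E : Set (ℝ≥0 → ℝ) := {ω | swallowingTime (sleDriving κ ω) y = swallowingTime (sleDriving κ ω) ↑(y - η)}
    with hE
  have hEm : MeasurableSet E := measurableSet_sle_swallowingTime_eq_of_neg κ (by linarith) hy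
  have hsub : {ω : ℝ≥0 → ℝ | ¬ ∃ x : ℝ, x < y ∧
      swallowingTime (sleDriving κ ω) y = swallowingTime (sleDriving κ ω) x} ⊆ Eᶜ :=
    fun ω hω hωE ↦ hω ⟨y - η, by linarith, hωE⟩
  calc preWienerMeasure.real {ω : ℝ≥0 → ℝ | ¬ ∃ x : ℝ, x < y ∧
        swallowingTime (sleDriving κ ω) y = swallowingTime (sleDriving κ ω) x}
      ≤ preWienerMeasure.real Eᶜ := measureReal_mono hsub (measure_ne_top _ _)
    _ = 1 - preWienerMeasure.real E := by rw [measureReal_compl hEm, probReal_univ]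
    _ ≤ ε := by linarith [hbound (y - η) (by linarith) le_rfl]

/-! ### Deterministic link: the first hit of `realRay y` is not at `y` -/

namespace Loewner

variable {W : ℝ≥0 → ℝ} {γ : ℝ≥0 → ℂ}

/-- Rays on the negative side are nested: `realRay x ⊆ realRay y` for `x ≤ y < 0`. [folklore] -/
theorem realRay_subset_realRay_of_neg {x y : ℝ} (hy : y < 0) (hxy : x ≤ y) : realRay x ⊆ realRay y := by
  rintro z ⟨hz, -, hzx⟩
  exact ⟨hz, fun h ↦ absurd hy h.le.not_gt, fun _ ↦ (hzx (lt_of_le_of_lt hxy hy)).trans hxy⟩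

/-- **If a point beyond `y` on the same side is swallowed together with `y`, the first hit of
`realRay y` is not at `y`.** For a chain generated by `γ` with continuous driving function from
`0`, a real `y ≠ 0` and `x` with `|x| > |y|` on the same side such that `T_y = T_x`: if
`firstHit γ (realRay y) = t₀` then `γ t₀ ≠ y`. Otherwise `T_y = t₀`
(`swallowingTime_ofReal_eq_firstHit_of_ne`) while `γ[0, t₀]` misses the strictly smaller ray
`realRay x` (off `realRay y ⊇ realRay x` before `t₀`, at `y ∉ realRay x` at time `t₀`), so that
`T_x = firstHit γ (realRay x) > t₀`. (Cf. Lawler (2005), proof of Prop. 6.10: "`γ(T_1)` is the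
largest real `x` with `T_x = T_1`".) [cite: RohdeSchramm2005, Thm 6.4 (proof, p. 908)] -/
theorem IsGeneratedByCurve.apply_ne_of_firstHit_eq_of_swallowingTime_eq (hγ : IsGeneratedByCurve W γ)
    (hW : Continuous W) (hW0 : W 0 = 0) {y x : ℝ} (hy : y ≠ 0)
    (hside : (0 < y ∧ y < x) ∨ (x < y ∧ y < 0))
    (hT : swallowingTime W y = swallowingTime W x) {t₀ : ℝ≥0}
    (ht₀ : firstHit γ (realRay y) = t₀) : γ t₀ ≠ y := by
  intro hγt₀
  have hx : x ≠ 0 := by rcases hside with ⟨h1, h2⟩ | ⟨h1, h2⟩ <;> [exact (h1.trans h2).ne'; exact (h1.trans h2).ne]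
  have hsub : realRay x ⊆ realRay y := by
    rcases hside with ⟨h1, h2⟩ | ⟨h1, h2⟩
    · exact realRay_subset_realRay_of_pos h1 h2.le
    · exact realRay_subset_realRay_of_neg h2 h1.le
  have hynot : (y : ℂ) ∉ realRay x := by
    rintro ⟨-, h1, h2⟩
    rcases hside with ⟨h3, h4⟩ | ⟨h3, h4⟩
    · have := h1 (h3.trans h4); rw [Complex.ofReal_re] at this; linarith
    · have := h2 (h3.trans h4); rw [Complex.ofReal_re] at this; linarith
  -- `T_y = t₀` and `T_x = firstHit γ (realRay x)`
  have hTy : swallowingTime W y = t₀ := by rw [swallowingTime_ofReal_eq_firstHit_of_ne hW hW0 hγ hy, ht₀]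
  have hTx : swallowingTime W x = firstHit γ (realRay x) := swallowingTime_ofReal_eq_firstHit_of_ne hW hW0 hγ hx
  -- `γ[0, t₀]` misses `realRay x`, hence `firstHit γ (realRay x) > t₀`
  have hmiss : ∀ s : ℝ≥0, s ≤ t₀ → γ s ∉ realRay x := by
    intro s hs
    rcases hs.lt_or_eq with hlt | rfl
    · exact fun h ↦ notMem_of_lt_firstHit (γ := γ) (S := realRay y) (by rw [ht₀]; exact_mod_cast hlt) (hsub h)
    · rw [hγt₀]; exact hynot
  have hgt : (t₀ : WithTop ℝ≥0) < firstHit γ (realRay x) := by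
    by_contra hle
    rw [not_lt] at hle
    have hfin : firstHit γ (realRay x) ≠ ⊤ := ne_top_of_le_ne_top WithTop.coe_ne_top hle
    obtain ⟨s, hs, hγs⟩ := exists_firstHit_eq_coe hγ.continuous (isClosed_realRay x) hfin
    rw [hs] at hle
    exact hmiss s (by exact_mod_cast hle) hγs
  rw [← hTx, ← hT, hTy] at hgt
  exact lt_irrefl _ hgt

end Loewner

/-! ### Discharge: real points are a.s. not visited -/

/-- On a sample path whose chain is not generated by a curve the trace is the junk constant `0`,
which never meets `realRay x` for `x ≠ 0`: the first hitting time is `⊤`. [folklore] -/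
theorem firstHit_sleTrace_realRay_eq_top_of_not_exists {ω : ℝ≥0 → ℝ}
    (h : ¬ ∃ γ, Loewner.IsGeneratedByCurve (sleDriving κ ω) γ) (hx : x ≠ 0) :
    firstHit (sleTrace κ ω) (realRay x) = ⊤ := by
  have htr : sleTrace κ ω = fun _ ↦ ((sleDriving κ ω 0 : ℝ) : ℂ) := by
    rw [sleTrace, Loewner.trace, dif_neg h]
  refine firstHit_eq_top fun t ht ↦ ?_
  rw [htr, sleDriving_zero] at ht
  obtain ⟨-, h1, h2⟩ := ht
  rcases lt_or_gt_of_ne hx with hlt | hlt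
  · have := h2 hlt; simp at this; linarith
  · have := h1 hlt; simp at this; linarith

/-- **Rohde–Schramm (2005), Thm 6.4 / Lemma 6.6, real points (proved)**: discharge of the named
fact `ae_sleTrace_firstHit_realRay_ne` — for `4 < κ < 8` and real `x ≠ 0`, almost surely, if the
SLE_κ trace hits `realRay x` first at time `t₀`, then `γ(t₀) ≠ x`. On paths generated by a curve:
a.s. some point beyond `x` on the same side is swallowed together with `x`
(`ae_exists_swallowingTime_eq_of_pos` / `_of_neg`, the sharp same-side swallowing estimate), and
then `Loewner.IsGeneratedByCurve.apply_ne_of_firstHit_eq_of_swallowingTime_eq`; on the other paths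
the junk trace never meets the ray. [cite: RohdeSchramm2005, Lemma 6.6 and Thm 6.4 (proof, p. 908)] -/
theorem ae_sleTrace_firstHit_realRay_ne_holds : ae_sleTrace_firstHit_realRay_ne := by
  intro κ hκ4 hκ8 x hx
  have hae : ∀ᵐ ω ∂preWienerMeasure, ∃ x' : ℝ, ((0 < x ∧ x < x') ∨ (x' < x ∧ x < 0)) ∧
      swallowingTime (sleDriving κ ω) x = swallowingTime (sleDriving κ ω) x' := by
    rcases lt_or_gt_of_ne hx with hneg | hpos
    · filter_upwards [ae_exists_swallowingTime_eq_of_neg hκ4 hκ8 hneg] with ω ⟨x', hx', hT⟩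
      exact ⟨x', Or.inr ⟨hx', hneg⟩, hT⟩
    · filter_upwards [ae_exists_swallowingTime_eq_of_pos hκ4 hκ8 hpos] with ω ⟨x', hx', hT⟩
      exact ⟨x', Or.inl ⟨hpos, hx'⟩, hT⟩
  filter_upwards [hae] with ω ⟨x', hside, hT⟩ t₀ ht₀
  by_cases hg : ∃ γ, Loewner.IsGeneratedByCurve (sleDriving κ ω) γ
  · exact (Loewner.isGeneratedByCurve_trace hg).apply_ne_of_firstHit_eq_of_swallowingTime_eq
      (continuous_sleDriving κ ω) (sleDriving_zero κ ω) hx hside hT ht₀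
  · rw [firstHit_sleTrace_realRay_eq_top_of_not_exists hg hx] at ht₀
    exact absurd ht₀ WithTop.top_ne_coe

/-- **A fixed real point `x ≠ 0` is a.s. not on the SLE_κ trace, `4 < κ < 8`** (Rohde–Schramm
(2005), proof of Thm 6.4: "`1 ∉ γ[0, ∞)` a.s., and the same follows for every `z ∈ ℝ ∖ {0}`"),
unconditionally: from `ae_sleTrace_firstHit_realRay_ne_holds` through the proved topology
`Loewner.IsGeneratedByCurve.ofReal_notMem_range_of_apply_firstHit_ne` on generated paths, and the
junk trace `0 ≠ x` otherwise. [cite: RohdeSchramm2005, Thm 6.4 (proof, p. 908)] -/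
theorem ae_ofReal_notMem_range_sleTrace (hκ4 : 4 < κ) (hκ8 : κ < 8) (hx : x ≠ 0) :
    ∀ᵐ ω ∂preWienerMeasure, (x : ℂ) ∉ range (sleTrace κ ω) := by
  filter_upwards [ae_sleTrace_firstHit_realRay_ne_holds hκ4 hκ8 hx] with ω hω
  by_cases hg : ∃ γ, Loewner.IsGeneratedByCurve (sleDriving κ ω) γ
  · exact (Loewner.isGeneratedByCurve_trace hg).ofReal_notMem_range_of_apply_firstHit_ne
      (continuous_sleDriving κ ω) (sleDriving_zero κ ω) hx hω
  · rw [range_sleTrace_of_not_exists ω hg, mem_singleton_iff, Complex.ofReal_eq_zero]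
    exact hx

end Literature.Probability.RandomPlanarGeometry
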